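import Summits.QuantumFields.BalabanUV.Beta.SymMixedWardPacking
import Summits.QuantumFields.BalabanUV.Beta.SymWardLettersUnpacking
import Summits.QuantumFields.BalabanUV.Beta.SymMixedWardSiteLaw
import Summits.QuantumFields.BalabanUV.Beta.SymBorderWardSiteLaw
import Summits.QuantumFields.BalabanUV.Beta.SpineRecursiveParity

/-!
# `BalabanUV.Beta.SymWardLettersAn1` — THE hW WARD-LETTER BLOCK OF THE SYM ROW ROOT `RowD1JointEndSymReflTablesAn1S2` DISCHARGED AT ZERO BORDER
# REMAINDERS: (T2-B) both slots, level 0 and level j+1, at lockB `cB = −Lc¹²∕4` (`Lc` odd) with `RB = RB″ = 0`; (T2-M₂) every level with the EXPLICIT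
# remainder `RM := symRMAn1 Lc cΛ` (`= wM1 j • symRWof Lc cΛ`), its classes (every level) and — at the Λ-lock `cΛ·Lc⁴ = 2` — its row parity
# (β sub-cell, row D1, TABLES-SYM-LEAN S2d; an1 gen 43, over an1's `SymMixedWardPacking` ∕ `SymWardLettersUnpacking` ∕ `SymMixedWardSiteLaw` ∕ `SymBorderWardSiteLaw`)

HONEST FRAMING (cell charter, verbatim): «discharging BetaPertH makes Bałaban's UV stability UNCONDITIONAL — a real
constructive-QFT result; it is NOT the continuum limit and NOT the Clay problem.»  HONEST DEPENDENCY (verbatim): «continuum YM on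
T⁴ ⇐ BetaPertH ∧ nine spine estimates (0/9 proved); BetaPertH ⇐ (D1) ∧ (D4) ∧ CAP+tail; G-an2-4 gates asym, D1 and NE2/3/4.»
ABSOLUTE RULE (R-g25-7 ∕ R-D1-g30-1 (A)): the (0.4)-symmetrised averaging is the exp of the MEAN OF LOGS over the pair family
`{loop^{σ,σ′}}` with weight `((d!)²·L^d)⁻¹`; every object below is the comb module's algebra read on an1's `symPhiGAt` (S2b part 1)
instead of `PhiGAt` — STATEMENT FOR STATEMENT under the dictionary `PhiXAt ↦ symPhiXAt`, `XjetAt ↦ symXjetAt`, `MσXAt ↦ symMσXAt`,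
`L^{-d}·linAvgAt ↦ (d!·L^d)⁻¹·symLinU`, `L^{-d}·hessUAt ↦ ((d!)²L^d)⁻¹·symHessUAt`, `L^{-2d}·vhUAt ↦ ((d!)²L^{2d})⁻¹·symVhUAt`
(an3-g63 [AN3-G63-S2C] (C-ii): constants PER BCH ORDER; CONVENTION `(d!)²` un-normalised inside order-2 sym functionals).
FAMILY-INDEPENDENT chart ∕ letter ∕ `Tau`-algebra lemmas of the comb module are imported BY NAME, never re-proved.
DERIVED cell leaf: [folklore] ring algebra; the `sym*` families are [our object]s.  No statement of Bałaban's papers is typed here, no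
`[cite:]` tag, no `Prop` is minted, no binder of the β-function wall (`hW`/`hR`/`D1Tel`/`D1Rep`, (D1), `BetaPertH`) is instantiated or
discharged; nothing about the VALUES of `symMixFFAt`∕`symVh₂SAt` and no (T2-B)∕(T2-M₂) letter is discharged in this file.
NOT D1, NOT BetaPertH, NOT continuum, NOT Clay.  NOT summit progress.
Provenance: β sub-cell, TABLES-SYM-LEAN S2c option (C) (S2C-SCOPE-v1 94facb80ac685517), unit b2b-balaban-beta-an1-g43 (W-supplier AN1,
FREEZE (0): scratch for a courier; an1 files nothing), 2026-08-21; no existing file touched.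

## What this module proves (`ρ_c = ctr 4 Lc`, `D_Y = diagK (½ Σ_v legInd ρ_c (Lc•Y + v))`, `c = −Lc⁴·½·Lc⁴`; every statement below is the corresponding binder of
## `RowD1JointEndSymReflTablesAn1S2.d1Drift_JsB12Sym_an1TablesS2_of_bordMixLetters_reflTableLetters_D1Tel_D1Rep` VERBATIM under the instantiation
## `RB := 0`, `RB'' := 0`, `RM := symRMAn1 Lc cΛ`, `cB := −Lc¹²∕4`)
* §1 level scaling: `wM2 j = stepScale j · wM1 j`, `wB2 j = stepScale j · wVH j` (`d = 3`, by `ring`), `a • Σ_v divV (b • F) = (a·b) • Σ_v divV F`, `M1Of … cΛ j = wM1 j • M1Of … cΛ 0`.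
* §2 (T2-M₂): `symRMAn1`; **`hM₂_sym`** (binder `hM₂`, EVERY `cΛ`, every level — level `j` is `wM1 j •` level `0`, and level `0` holds by definition of `symRWof`);
  **`hRMp_sym`** (binder `hRMp`) from (WM-bond)_sym at `cΛ`, **`hRMp_sym_of_lock`** at the Λ-lock `cΛ·Lc⁴ = 2` (an1's `SymMixedWardSiteLaw.symBondWardM`, UNCONDITIONAL);
  **`vertexFamily_symRMAn1`**, **`hcls_sym`** (binders `hcls0` = level `0`, `hclsS j` = level `j+1`, with the two zero border remainders).
* §3 (T2-B): **`hBord0_sym`, `hBord0''_sym`, `hBordS_sym`, `hBordS''_sym`** (binders `hBord0 hBord0'' hBordS hBordS''` with `RB = RB'' = 0`) at lockB, `Lc` odd, from an1's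
  `SymBorderWardSiteLaw.symBondWardB` through `SymWardLettersUnpacking.hBord0_of_bondWard ∕ hBord0''_of_bondWard` and the level scaling (`wB2 = stepScale·wVH`);
  **`hRBp_zero`** (binders `hRBp hRB''p` for the zero remainder).
HONEST: the hW side of the sym row root is thereby reduced to NOTHING displayed (10 binders: `hcls0 hclsS hRBp hRB''p hRMp hBord0 hBord0'' hBordS hBordS'' hM₂`) at the two
locks; the hR side (reflection letters), `hcomp`, D1Tel, D1Rep, the B5 facts and the window are untouched.  No binder is instantiated IN this file (the root is not
imported); NOT D1, NOT `BetaPertH`, NOT continuum, NOT Clay.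
-/

open Finset
open scoped BigOperators
open Literature.MathematicalPhysics.QuantumFieldTheory
open Literature.MathematicalPhysics.QuantumFieldTheory.Balaban1983to89
open Literature.MathematicalPhysics.QuantumFieldTheory.Balaban1983to89.Beta
open ExpKernelCalculus (MKer BiLoc VertexFamily comp)
open KernelWard (divV)
open AffineAveraging (box toSite)
open AveragingContours (blk off)
open AveragingContoursRooted (ctr ctrOff)
open OneStepResolventKernel (Fib LocStencil)
open BalabanStepJetsSucc (wVH)
open BalabanStepW2 (M2Of wM1 wM2 wB2)
open Summit.QuantumFields.BalabanUV.Beta.TameKernelCalculus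
open Summit.QuantumFields.BalabanUV.Beta.BorderedHessian (diagK stepScale sgnK)
open Summit.QuantumFields.BalabanUV.Beta.AveragingWardRootedStencils (legInd)
open Summit.QuantumFields.BalabanUV.Beta.SpineRooted (M1Of M1Of_apply)
open Summit.QuantumFields.BalabanUV.Beta.WardLocusStencils (divV_apply)
open Summit.QuantumFields.BalabanUV.Beta.WardLocusParityLevels (M2Of_apply comm_smul)
open Summit.QuantumFields.BalabanUV.Beta.SpineRecursiveParity (parityOdd_smul parityOdd_zero)
open Summit.QuantumFields.BalabanUV.Beta.SymAveragingHessianCounts (symVhSAt symVhKerAt symHessFFAt symHessKerAt biLoc_smul_ff)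
open Summit.QuantumFields.BalabanUV.Beta.SymAveragingMixedJetTables (symMixFFAt symMixKerAt symVh2KerAt)
open Summit.QuantumFields.BalabanUV.Beta.SymSecondOrderTablesAn1 (symVh₂SAn1)
open Summit.QuantumFields.BalabanUV.Beta.SymMixedWardPacking (symRWof symWardMixed_symRWof parityOdd_symRWof_of_bondLaw vertexFamily_symRWof)
open Summit.QuantumFields.BalabanUV.Beta.SymWardLettersUnpacking (hBord0_of_bondWard hBord0''_of_bondWard)
open Summit.QuantumFields.BalabanUV.Beta.SymMixedWardSiteLaw (symBondWardM)
open Summit.QuantumFields.BalabanUV.Beta.SymBorderWardSiteLaw (symBondWardB)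

namespace Summit.QuantumFields.BalabanUV.Beta.SymWardLettersAn1

noncomputable section

variable {Lc : ℕ} [NeZero Lc]

/-! ## §1 Level scaling (`d = 3`) -/

omit [NeZero Lc] in
/-- [folklore] `stepScale 0 = 1`. -/
theorem stepScale_zero : stepScale 3 Lc 0 = 1 := by simp [BorderedHessian.stepScale]

/-- [folklore] `stepScale j ≠ 0` (`Lc ≠ 0`). -/
theorem stepScale_ne_zero (j : ℕ) : stepScale 3 Lc j ≠ 0 :=
  pow_ne_zero _ (pow_ne_zero _ (Nat.cast_ne_zero.2 (NeZero.ne Lc)))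

omit [NeZero Lc] in
/-- [folklore] `wM1 0 = 1`. -/
theorem wM1_zero : wM1 3 Lc 0 = 1 := by simp [BalabanStepW2.wM1]

omit [NeZero Lc] in
/-- [folklore] **`wM2 j = stepScale j · wM1 j`** (`(L^j)^{3(d+2)} = (L^j)^{d+2}·(L^j)^{2(d+2)}`). -/
theorem wM2_eq (j : ℕ) : wM2 3 Lc j = stepScale 3 Lc j * wM1 3 Lc j := by
  simp only [BalabanStepW2.wM2, BorderedHessian.stepScale, BalabanStepW2.wM1]
  ring

omit [NeZero Lc] in
/-- [folklore] **`wB2 j = stepScale j · wVH j`**. -/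
theorem wB2_eq (j : ℕ) : wB2 3 Lc j = stepScale 3 Lc j * wVH 3 Lc j := by
  simp only [BalabanStepW2.wB2, BorderedHessian.stepScale, BalabanStepJetsSucc.wVH]
  ring

omit [NeZero Lc] in
/-- [folklore] Scalars pass through the block-summed divergence: `a • Σ_v divV (b • F) (Lc•Y + v) = (a·b) • Σ_v divV F (Lc•Y + v)`. -/
theorem smul_sum_divV_smul (a b : ℝ) (F : Fin (3 + 1) → (Fin (3 + 1) → ℤ) → MKer (3 + 1) (Fib 3)) (Y : Fin (3 + 1) → ℤ) :
    a • ∑ v ∈ box (3 + 1) Lc, divV (fun κ u => b • F κ u) ((Lc : ℤ) • Y + toSite v) =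
      (a * b) • ∑ v ∈ box (3 + 1) Lc, divV F ((Lc : ℤ) • Y + toSite v) := by
  funext x z p q
  simp only [Pi.smul_apply, Finset.sum_apply, smul_eq_mul, divV_apply, Finset.mul_sum]
  refine Finset.sum_congr rfl fun v _ => Finset.sum_congr rfl fun μ _ => ?_
  ring

omit [NeZero Lc] in
/-- [folklore] `M1Of H cΛ j = wM1 j • M1Of H cΛ 0` (`wM1 0 = 1`). -/
theorem M1Of_level (H : Fin (3 + 1) → (Fin (3 + 1) → ℤ) → MKer (3 + 1) (Fib 3)) (cΛ : ℝ) (j : ℕ) (ρ' : Fin (3 + 1)) (w : Fin (3 + 1) → ℤ) :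
    M1Of 3 Lc H cΛ j ρ' w = wM1 3 Lc j • M1Of 3 Lc H cΛ 0 ρ' w := by
  rw [M1Of_apply, M1Of_apply, smul_smul, wM1_zero, mul_one, mul_comm (wM1 3 Lc j)]

/-! ## §2 (T2-M₂): the mixed Ward letter at every level with the explicit remainder `symRMAn1`, its classes and its parity -/

/-- [our object] **THE MIXED WARD REMAINDER OF THE SYM ROW ROOT, EVERY LEVEL**: `symRMAn1 Lc cΛ j y ρ′ w := wM1 j • symRWof Lc cΛ y ρ′ w`
(`symRWof` = an1's level-0 residual `symWardM − symDatM`). -/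
def symRMAn1 (Lc : ℕ) [NeZero Lc] (cΛ : ℝ) : ℕ → (Fin 4 → ℤ) → Fin 4 → (Fin 4 → ℤ) → MKer 4 (Fib 3) :=
  fun j y ρ' w => wM1 3 Lc j • symRWof Lc cΛ y ρ' w

/-- [folklore] **(T2-M₂) — THE BINDER `hM₂` OF THE SYM ROW ROOT WITH `RM := symRMAn1 Lc cΛ`, EVERY `cΛ`, EVERY LEVEL.**  Level `0` is
`SymMixedWardPacking.symWardMixed_symRWof` (by definition of the residual); level `j` is `wM1 j •` level `0`
(`wM2 j = stepScale j·wM1 j`, `M1Of … j = wM1 j • M1Of … 0`, `[w•T, D] = w•[T, D]`). -/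
theorem hM₂_sym (cΛ : ℝ) : ∀ (j : ℕ) (y : Fin 4 → ℤ) (ρ' : Fin 4) (w : Fin 4 → ℤ),
      (stepScale 3 Lc j * (Lc : ℝ) ^ (3 + 1))⁻¹ • ∑ v ∈ box (3 + 1) Lc, divV (fun κ u => M2Of 3 Lc (symMixFFAt (ctr 4 Lc) Lc) j κ u ρ' w) ((Lc : ℤ) • y + toSite v) =
        comp (M1Of 3 Lc (symHessFFAt (ctr 4 Lc) Lc) cΛ j ρ' w) (diagK ((1 / 2 : ℝ) • ∑ v ∈ box (3 + 1) Lc, legInd (ctr (3 + 1) Lc) ((Lc : ℤ) • y + toSite v)))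
          - comp (diagK ((1 / 2 : ℝ) • ∑ v ∈ box (3 + 1) Lc, legInd (ctr (3 + 1) Lc) ((Lc : ℤ) • y + toSite v))) (M1Of 3 Lc (symHessFFAt (ctr 4 Lc) Lc) cΛ j ρ' w)
          + symRMAn1 Lc cΛ j y ρ' w := by
  intro j y ρ' w
  have e4 : ctr (3 + 1) Lc = ctr 4 Lc := rfl
  have eM2 : ∀ i : ℕ, (fun κ u => M2Of 3 Lc (symMixFFAt (ctr 4 Lc) Lc) i κ u ρ' w) = fun κ u => wM2 3 Lc i • symMixFFAt (ctr 4 Lc) Lc κ u ρ' w :=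
    fun i => by funext κ u; rw [M2Of_apply]
  have h0 := symWardMixed_symRWof (Lc := Lc) cΛ y ρ' w
  rw [eM2 0, smul_sum_divV_smul] at h0
  rw [e4, eM2 j, smul_sum_divV_smul, M1Of_level (symHessFFAt (ctr 4 Lc) Lc) cΛ j ρ' w, comm_smul,
    show symRMAn1 Lc cΛ j y ρ' w = wM1 3 Lc j • symRWof Lc cΛ y ρ' w from rfl, ← smul_add, ← h0, smul_smul]
  congr 1
  have hs : stepScale 3 Lc j ≠ 0 := stepScale_ne_zero j
  rw [wM2_eq, wM2_eq, stepScale_zero, wM1_zero, mul_inv,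
    show (stepScale 3 Lc j)⁻¹ * ((Lc : ℝ) ^ (3 + 1))⁻¹ * (stepScale 3 Lc j * wM1 3 Lc j)
      = ((stepScale 3 Lc j)⁻¹ * stepScale 3 Lc j) * (((Lc : ℝ) ^ (3 + 1))⁻¹ * wM1 3 Lc j) from by ring,
    inv_mul_cancel₀ hs]
  ring

/-- [folklore] **THE BINDER `hRMp` WITH `RM := symRMAn1 Lc cΛ` FROM (WM-bond)_sym AT `cΛ`**: the level-0 residual is row-parity-odd
(`SymMixedWardPacking.parityOdd_symRWof_of_bondLaw`) and parity-oddness is stable under scalars (`parityOdd_smul`). -/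
theorem hRMp_sym (cΛ : ℝ)
    (hWM : ∀ (y : Fin (3 + 1) → ℤ) (ρ' : Fin (3 + 1)) (w : Fin (3 + 1) → ℤ) (β : Fin (3 + 1)) (x : Fin (3 + 1) → ℤ) (β' : Fin (3 + 1))
      (x' : Fin (3 + 1) → ℤ),
      ((Lc : ℝ) ^ (3 + 1))⁻¹ * (∑ v ∈ box (3 + 1) Lc, ∑ κ : Fin (3 + 1),
          ((symMixKerAt (ctr 4 Lc) Lc ρ' w (κ, (Lc : ℤ) • y + toSite v - B6BondElimination.unitVec κ) (β, x) (β', x')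
              - symMixKerAt (ctr 4 Lc) Lc ρ' w (κ, (Lc : ℤ) • y + toSite v) (β, x) (β', x'))
            + (symMixKerAt (ctr 4 Lc) Lc ρ' w (κ, (Lc : ℤ) • y + toSite v - B6BondElimination.unitVec κ) (β', x') (β, x)
              - symMixKerAt (ctr 4 Lc) Lc ρ' w (κ, (Lc : ℤ) • y + toSite v) (β', x') (β, x)))) =
        2 * (cΛ * symHessKerAt (ctr 4 Lc) Lc ρ' w (β, x) (β', x') *
          ((1 / 2 : ℝ) * (∑ v ∈ box (3 + 1) Lc, (if x' = (Lc : ℤ) • y + toSite v then (1 : ℝ) else 0))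
            - (1 / 2 : ℝ) * (∑ v ∈ box (3 + 1) Lc, (if x = (Lc : ℤ) • y + toSite v then (1 : ℝ) else 0))))) :
    ∀ (j : ℕ) (y : Fin 4 → ℤ) (ρ' : Fin 4) (w : Fin 4 → ℤ), trK (symRMAn1 Lc cΛ j y ρ' w) = -sgnK (symRMAn1 Lc cΛ j y ρ' w) :=
  fun j y ρ' w => parityOdd_smul (wM1 3 Lc j) (parityOdd_symRWof_of_bondLaw cΛ hWM y ρ' w)

/-- [folklore] **THE BINDER `hRMp` AT THE Λ-LOCK `cΛ·Lc⁴ = 2` — UNCONDITIONAL**: (WM-bond)_sym at `cΛ = 2∕Lc⁴` is an1's theorem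
`SymMixedWardSiteLaw.symBondWardM`. -/
theorem hRMp_sym_of_lock {cΛ : ℝ} (hΛ : cΛ * (Lc : ℝ) ^ 4 = 2) :
    ∀ (j : ℕ) (y : Fin 4 → ℤ) (ρ' : Fin 4) (w : Fin 4 → ℤ), trK (symRMAn1 Lc cΛ j y ρ' w) = -sgnK (symRMAn1 Lc cΛ j y ρ' w) := by
  have hL : (Lc : ℝ) ^ 4 ≠ 0 := pow_ne_zero _ (Nat.cast_ne_zero.2 (NeZero.ne Lc))
  have hc : cΛ = 2 / (Lc : ℝ) ^ 4 := by rw [eq_div_iff hL]; exact hΛ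
  subst hc
  exact hRMp_sym (2 / (Lc : ℝ) ^ 4) symBondWardM

/-- [folklore] **`symRMAn1 Lc cΛ j` IS A VERTEX FAMILY, CONSTANTS UNIFORM IN THE COARSE SITE** (every level; no hypothesis): `|wM1 j|·C₀` with an1's
`SymMixedWardPacking.vertexFamily_symRWof`. -/
theorem vertexFamily_symRMAn1 (hLc : 1 ≤ Lc) (cΛ : ℝ) (j : ℕ) : ∃ C δ : ℝ, 0 < δ ∧ ∀ y, VertexFamily (symRMAn1 Lc cΛ j y) Lc C δ := by
  obtain ⟨C, δ, hδ, h⟩ := vertexFamily_symRWof (Lc := Lc) hLc cΛ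
  exact ⟨|wM1 3 Lc j| * C, δ, hδ, fun y ρ' w => biLoc_smul_ff (h y ρ' w) (wM1 3 Lc j)⟩

omit [NeZero Lc] in
/-- [folklore] The zero border remainder is in every `LocStencil` class with a nonnegative constant. -/
theorem locStencil_zero {C δ : ℝ} (hC : 0 ≤ C) (j : ℕ) (Y : Fin 4 → ℤ) :
    LocStencil ((0 : ℕ → (Fin 4 → ℤ) → Fin 4 → (Fin 4 → ℤ) → MKer 4 (Fib 3)) j Y) C δ := fun κ u x z a b => by
  simp only [Pi.zero_apply, abs_zero]
  exact mul_nonneg hC (Real.exp_pos _).le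

/-- [folklore] **THE CLASS BINDERS `hcls0` (`j = 0`) AND `hclsS j` (level `j+1`) WITH `RB = RB'' = 0`, `RM := symRMAn1 Lc cΛ`** — one rate per level,
no hypothesis. -/
theorem hcls_sym (hLc : 1 ≤ Lc) (cΛ : ℝ) (j : ℕ) : ∃ C δ : ℝ, 0 < δ ∧
    (∀ Y, LocStencil ((0 : ℕ → (Fin 4 → ℤ) → Fin 4 → (Fin 4 → ℤ) → MKer 4 (Fib 3)) j Y) C δ) ∧
    (∀ Y, LocStencil ((0 : ℕ → (Fin 4 → ℤ) → Fin 4 → (Fin 4 → ℤ) → MKer 4 (Fib 3)) j Y) C δ) ∧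
    (∀ y, VertexFamily (symRMAn1 Lc cΛ j y) Lc C δ) := by
  obtain ⟨C, δ, hδ, h⟩ := vertexFamily_symRMAn1 (Lc := Lc) hLc cΛ j
  have hC : 0 ≤ C := (h 0 0 0).nonneg (Sum.inl 0)
  exact ⟨C, δ, hδ, locStencil_zero hC j, locStencil_zero hC j, h⟩

/-- [folklore] **THE PARITY BINDERS `hRBp` ∕ `hRB''p` FOR THE ZERO BORDER REMAINDER.** -/
theorem hRBp_zero : ∀ (j : ℕ) (Y : Fin 4 → ℤ) (κ : Fin 4) (u : Fin 4 → ℤ),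
    trK ((0 : ℕ → (Fin 4 → ℤ) → Fin 4 → (Fin 4 → ℤ) → MKer 4 (Fib 3)) j Y κ u) =
      -sgnK ((0 : ℕ → (Fin 4 → ℤ) → Fin 4 → (Fin 4 → ℤ) → MKer 4 (Fib 3)) j Y κ u) :=
  fun _ _ _ _ => parityOdd_zero

/-! ## §3 (T2-B): the border Ward letters, both slots, level 0 and level j+1, at lockB `cB = −Lc¹²∕4`, `Lc` odd, remainder zero -/

/-- [folklore] **LEVEL SCALING OF THE BORDER WARD LETTER**: if the level-0 letter holds with weight `cB` and coupling `c`, the level-`(j+1)` letter holds with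
`cB·wB2 (j+1)` and `c·wVH (j+1)` (`wB2 = stepScale·wVH`, scalars through `Σ_v divV`, `[w•V, D] = w•[V, D]`). -/
theorem border_level_succ (cB c : ℝ) (F : Fin (3 + 1) → (Fin (3 + 1) → ℤ) → MKer (3 + 1) (Fib 3)) (V D : MKer (3 + 1) (Fib 3))
    (Y : Fin (3 + 1) → ℤ) (j : ℕ)
    (h0 : (stepScale 3 Lc 0 * (Lc : ℝ) ^ (3 + 1))⁻¹ • ∑ v ∈ box (3 + 1) Lc, divV (fun κ u => cB • F κ u) ((Lc : ℤ) • Y + toSite v) =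
      comp (c • V) D - comp D (c • V)) :
    (stepScale 3 Lc (j + 1) * (Lc : ℝ) ^ (3 + 1))⁻¹ • ∑ v ∈ box (3 + 1) Lc, divV (fun κ u => (cB * wB2 3 Lc (j + 1)) • F κ u) ((Lc : ℤ) • Y + toSite v) =
      comp ((c * wVH 3 Lc (j + 1)) • V) D - comp D ((c * wVH 3 Lc (j + 1)) • V) := by
  rw [smul_sum_divV_smul] at h0
  rw [smul_sum_divV_smul, show c * wVH 3 Lc (j + 1) = wVH 3 Lc (j + 1) * c from mul_comm _ _, mul_smul (wVH 3 Lc (j + 1)) c V,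
    comm_smul, ← h0, smul_smul]
  congr 1
  have hs : stepScale 3 Lc (j + 1) ≠ 0 := stepScale_ne_zero (j + 1)
  rw [wB2_eq, stepScale_zero, one_mul, mul_inv,
    show (stepScale 3 Lc (j + 1))⁻¹ * ((Lc : ℝ) ^ (3 + 1))⁻¹ * (cB * (stepScale 3 Lc (j + 1) * wVH 3 Lc (j + 1)))
      = ((stepScale 3 Lc (j + 1))⁻¹ * stepScale 3 Lc (j + 1)) * (((Lc : ℝ) ^ (3 + 1))⁻¹ * cB * wVH 3 Lc (j + 1)) from by ring,
    inv_mul_cancel₀ hs]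
  ring

/-- [folklore] **THE BINDER `hBord0` WITH `RB := 0` AT lockB, `Lc` ODD — DISCHARGED** (`SymWardLettersUnpacking.hBord0_of_bondWard` of an1's
`SymBorderWardSiteLaw.symBondWardB`). -/
theorem hBord0_sym (hLc : Odd Lc) : ∀ (Y : Fin 4 → ℤ) (κ' : Fin 4) (u' : Fin 4 → ℤ),
      (stepScale 3 Lc 0 * (Lc : ℝ) ^ (3 + 1))⁻¹ • ∑ v ∈ box (3 + 1) Lc,
          divV (fun κ u => (-((Lc : ℝ) ^ 12 / 4)) • symVh₂SAn1 3 Lc κ u κ' u') ((Lc : ℤ) • Y + toSite v) =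
        comp ((-((Lc : ℝ) ^ (3 + 1) * (1 / 2) * (Lc : ℝ) ^ (3 + 1))) • symVhSAt (ctr 4 Lc) 3 Lc rfl κ' u')
            (diagK ((1 / 2 : ℝ) • ∑ v ∈ box (3 + 1) Lc, legInd (ctr (3 + 1) Lc) ((Lc : ℤ) • Y + toSite v)))
          - comp (diagK ((1 / 2 : ℝ) • ∑ v ∈ box (3 + 1) Lc, legInd (ctr (3 + 1) Lc) ((Lc : ℤ) • Y + toSite v)))
            ((-((Lc : ℝ) ^ (3 + 1) * (1 / 2) * (Lc : ℝ) ^ (3 + 1))) • symVhSAt (ctr 4 Lc) 3 Lc rfl κ' u')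
          + (0 : ℕ → (Fin 4 → ℤ) → Fin 4 → (Fin 4 → ℤ) → MKer 4 (Fib 3)) 0 Y κ' u' := by
  intro Y κ' u'
  have e4 : ctr (3 + 1) Lc = ctr 4 Lc := rfl
  rw [e4]
  simp only [Pi.zero_apply, add_zero]
  exact hBord0_of_bondWard (-((Lc : ℝ) ^ 12 / 4)) (symBondWardB hLc) Y κ' u'

/-- [folklore] **THE BINDER `hBord0''` WITH `RB'' := 0` AT lockB, `Lc` ODD — DISCHARGED.** -/
theorem hBord0''_sym (hLc : Odd Lc) : ∀ (Y : Fin 4 → ℤ) (κ : Fin 4) (u : Fin 4 → ℤ),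
      (stepScale 3 Lc 0 * (Lc : ℝ) ^ (3 + 1))⁻¹ • ∑ v ∈ box (3 + 1) Lc,
          divV (fun κ' u' => (-((Lc : ℝ) ^ 12 / 4)) • symVh₂SAn1 3 Lc κ u κ' u') ((Lc : ℤ) • Y + toSite v) =
        comp ((-((Lc : ℝ) ^ (3 + 1) * (1 / 2) * (Lc : ℝ) ^ (3 + 1))) • symVhSAt (ctr 4 Lc) 3 Lc rfl κ u)
            (diagK ((1 / 2 : ℝ) • ∑ v ∈ box (3 + 1) Lc, legInd (ctr (3 + 1) Lc) ((Lc : ℤ) • Y + toSite v)))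
          - comp (diagK ((1 / 2 : ℝ) • ∑ v ∈ box (3 + 1) Lc, legInd (ctr (3 + 1) Lc) ((Lc : ℤ) • Y + toSite v)))
            ((-((Lc : ℝ) ^ (3 + 1) * (1 / 2) * (Lc : ℝ) ^ (3 + 1))) • symVhSAt (ctr 4 Lc) 3 Lc rfl κ u)
          + (0 : ℕ → (Fin 4 → ℤ) → Fin 4 → (Fin 4 → ℤ) → MKer 4 (Fib 3)) 0 Y κ u := by
  intro Y κ u
  have e4 : ctr (3 + 1) Lc = ctr 4 Lc := rfl
  rw [e4]
  simp only [Pi.zero_apply, add_zero]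
  exact hBord0''_of_bondWard (-((Lc : ℝ) ^ 12 / 4)) (symBondWardB hLc) Y κ u

/-- [folklore] **THE BINDER `hBordS` WITH `RB := 0` AT lockB, `Lc` ODD — DISCHARGED** (level `j+1` = `wVH (j+1) •` level `0`, `border_level_succ`). -/
theorem hBordS_sym (hLc : Odd Lc) : ∀ (j : ℕ) (Y : Fin 4 → ℤ) (κ' : Fin 4) (u' : Fin 4 → ℤ),
      (stepScale 3 Lc (j + 1) * (Lc : ℝ) ^ (3 + 1))⁻¹ • ∑ v ∈ box (3 + 1) Lc,
          divV (fun κ u => ((-((Lc : ℝ) ^ 12 / 4)) * wB2 3 Lc (j + 1)) • symVh₂SAn1 3 Lc κ u κ' u') ((Lc : ℤ) • Y + toSite v) =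
        comp (((-((Lc : ℝ) ^ (3 + 1) * (1 / 2) * (Lc : ℝ) ^ (3 + 1))) * wVH 3 Lc (j + 1)) • symVhSAt (ctr 4 Lc) 3 Lc rfl κ' u')
            (diagK ((1 / 2 : ℝ) • ∑ v ∈ box (3 + 1) Lc, legInd (ctr (3 + 1) Lc) ((Lc : ℤ) • Y + toSite v)))
          - comp (diagK ((1 / 2 : ℝ) • ∑ v ∈ box (3 + 1) Lc, legInd (ctr (3 + 1) Lc) ((Lc : ℤ) • Y + toSite v)))
            (((-((Lc : ℝ) ^ (3 + 1) * (1 / 2) * (Lc : ℝ) ^ (3 + 1))) * wVH 3 Lc (j + 1)) • symVhSAt (ctr 4 Lc) 3 Lc rfl κ' u')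
          + (0 : ℕ → (Fin 4 → ℤ) → Fin 4 → (Fin 4 → ℤ) → MKer 4 (Fib 3)) (j + 1) Y κ' u' := by
  intro j Y κ' u'
  have e4 : ctr (3 + 1) Lc = ctr 4 Lc := rfl
  rw [e4]
  simp only [Pi.zero_apply, add_zero]
  exact border_level_succ (-((Lc : ℝ) ^ 12 / 4)) (-((Lc : ℝ) ^ (3 + 1) * (1 / 2) * (Lc : ℝ) ^ (3 + 1)))
    (fun κ u => symVh₂SAn1 3 Lc κ u κ' u') (symVhSAt (ctr 4 Lc) 3 Lc rfl κ' u')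
    (diagK ((1 / 2 : ℝ) • ∑ v ∈ box (3 + 1) Lc, legInd (ctr 4 Lc) ((Lc : ℤ) • Y + toSite v))) Y j
    (hBord0_of_bondWard (-((Lc : ℝ) ^ 12 / 4)) (symBondWardB hLc) Y κ' u')

/-- [folklore] **THE BINDER `hBordS''` WITH `RB'' := 0` AT lockB, `Lc` ODD — DISCHARGED.** -/
theorem hBordS''_sym (hLc : Odd Lc) : ∀ (j : ℕ) (Y : Fin 4 → ℤ) (κ : Fin 4) (u : Fin 4 → ℤ),
      (stepScale 3 Lc (j + 1) * (Lc : ℝ) ^ (3 + 1))⁻¹ • ∑ v ∈ box (3 + 1) Lc,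
          divV (fun κ' u' => ((-((Lc : ℝ) ^ 12 / 4)) * wB2 3 Lc (j + 1)) • symVh₂SAn1 3 Lc κ u κ' u') ((Lc : ℤ) • Y + toSite v) =
        comp (((-((Lc : ℝ) ^ (3 + 1) * (1 / 2) * (Lc : ℝ) ^ (3 + 1))) * wVH 3 Lc (j + 1)) • symVhSAt (ctr 4 Lc) 3 Lc rfl κ u)
            (diagK ((1 / 2 : ℝ) • ∑ v ∈ box (3 + 1) Lc, legInd (ctr (3 + 1) Lc) ((Lc : ℤ) • Y + toSite v)))
          - comp (diagK ((1 / 2 : ℝ) • ∑ v ∈ box (3 + 1) Lc, legInd (ctr (3 + 1) Lc) ((Lc : ℤ) • Y + toSite v)))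
            (((-((Lc : ℝ) ^ (3 + 1) * (1 / 2) * (Lc : ℝ) ^ (3 + 1))) * wVH 3 Lc (j + 1)) • symVhSAt (ctr 4 Lc) 3 Lc rfl κ u)
          + (0 : ℕ → (Fin 4 → ℤ) → Fin 4 → (Fin 4 → ℤ) → MKer 4 (Fib 3)) (j + 1) Y κ u := by
  intro j Y κ u
  have e4 : ctr (3 + 1) Lc = ctr 4 Lc := rfl
  rw [e4]
  simp only [Pi.zero_apply, add_zero]
  exact border_level_succ (-((Lc : ℝ) ^ 12 / 4)) (-((Lc : ℝ) ^ (3 + 1) * (1 / 2) * (Lc : ℝ) ^ (3 + 1)))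
    (fun κ' u' => symVh₂SAn1 3 Lc κ u κ' u') (symVhSAt (ctr 4 Lc) 3 Lc rfl κ u)
    (diagK ((1 / 2 : ℝ) • ∑ v ∈ box (3 + 1) Lc, legInd (ctr 4 Lc) ((Lc : ℤ) • Y + toSite v))) Y j
    (hBord0''_of_bondWard (-((Lc : ℝ) ^ 12 / 4)) (symBondWardB hLc) Y κ u)

end

end Summit.QuantumFields.BalabanUV.Beta.SymWardLettersAn1
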